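import Literature.AlgebraicGeometry.Resolution.BlowupStalkCharts
import Literature.AlgebraicGeometry.Resolution.ColonIdealSheafFG
import Literature.AlgebraicGeometry.Resolution.HypersurfaceTransform
import Summits.ResolutionOfSingularities.ResolutionOfSingularities.Theorems.FrobeniusClosingPatchingRelPerfectDepthSNCPointwise
import HarnessLib

/-!
# Crux `PatchingRelPerfect` (stmt-ResolutionOfSingularities-16161), chain W5.2 — rung «r-cone-ℓ», scheme level I: ALL THE CHARTS
# of a blowing up over a point, and the stalk dictionary for pulled-back and controlled-transformed ideal sheaves

[OURS · L1 W5.2 · rung tool] Replaces the role of NO printed item; NOT a statement of the manuscript under review; fact-free.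
AI-written (AI review is weaker than expert review).

The tree's `IsBlowup.exists_chart_morphism` (`BlowupStalkCharts.lean`, Stacks 0804) gives, for EACH point `x'` of a blowing up
`σ : X' → X` along `J` and generators `c` of `J_{σ x'}`, SOME chart `q : Spec B_j → X'` through `x'` computing its local ring.  The
vertex step of the rung «r-cone-ℓ» needs the charts UNIFORMLY over a fixed point `z ∈ V(J)` (to single out the new vertex as the
image of ONE prime of ONE chart): this file packages the same construction (base change to `Spec 𝒪_{X,z}`, uniqueness of
blowing ups, the charts `D₊(c_j t)` of `Proj 𝒪_{X,z}[J_z t]`) as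
* `exists_charts_over` — a family `q_j : Spec B_j → X'`, `B_j = (𝒪_{X,z}[J_z t])_{(c_j t)}`, ALL lying over
  `Spec B_j → Spec 𝒪_{X,z} → X`, inducing isomorphisms on local rings, and JOINTLY COVERING the fibre: every `x'` with `σ x' = z`
  is `q_j w` for some `j`, `w`;
* `exists_stalk_presentation` — at `x' = q_j w` (`σ x' = z`): a ring map `χ : B_j → 𝒪_{X',x'}` over `σ^♯` presenting `𝒪_{X',x'}`
  as the localisation of `B_j` at `w`, with `w` over `𝔪_z` (the tree's `exists_stalk_ringHom_of_chart`, transported along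
  `σ x' = z`);
* the STALK DICTIONARY in such a presentation: `stalkIdeal_comap_of_presentation` (`(σ^*K)_{x'} = χ(φ K_z)·𝒪`),
  `stalkIdeal_exceptional_of_presentation` (`(J·𝒪_{X'})_{x'} = (χ φ c_j)`), and `stalkIdeal_controlledTransform_of_presentation`
  (if `K_z = (k)` with `φ k = φ(c_j)^μ · f` in `B_j`, then `σᶜ(K, μ)_{x'} = (χ f)`).

## References
* The Stacks Project, Tag 0804 (charts of a blowing up), Tag 01J7 (`Spec 𝒪_{X,x} → X`). [StacksProject]
* U. Görtz, T. Wedhorn, *Algebraic Geometry I*, 2nd ed. (2020), Def. 13.90, (13.19) p. 414. [GortzWedhorn2020]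
* M. Temkin, *Desingularization of quasi-excellent schemes in characteristic zero*, Adv. Math. 219 (2008), §2.1 (pro-open
  pro-subschemes). [Temkin2008]
-/

-- `Summit.<Summit>.<Sub>.Theorems` with `Sub = Summit` (single-conjunct summit, D-0017)
set_option linter.dupNamespace false

noncomputable section

open CategoryTheory CategoryTheory.Limits AlgebraicGeometry TopologicalSpace IsLocalRing
open Literature.AlgebraicGeometry.Resolution
open Scheme.IdealSheafData

namespace Summit.ResolutionOfSingularities.ResolutionOfSingularities.Theorems

universe u

namespace ConeDepth

variable {X' X : Scheme.{u}} {σ : X' ⟶ X} {J : X.IdealSheafData}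

/-! ## §1 All the charts over a point -/

/-- **All the charts of a blowing up over a point.**  Let `σ : X' → X` be a blowing up along `J`, `z ∈ X`, and
`c₁, …, c_k ∈ 𝒪_{X,z}` generators of `J_z`.  Then there are morphisms `q_j : Spec B_j → X'`, `B_j = (𝒪_{X,z}[J_z t])_{(c_j t)}`
(`j = 1, …, k`), each lying over `Spec B_j → Spec 𝒪_{X,z} → X` and inducing isomorphisms on all local rings, such that every
point `x'` of `X'` with `σ x' = z` is `q_j w` for some `j` and `w`.  (The charts `D₊(c_j t)` of `Proj 𝒪_{X,z}[J_z t] ≅ X' ×_X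
Spec 𝒪_{X,z}` followed by the projection.) [cite: StacksProject, Tag 0804] [cite: Temkin2008, §2.1 (p. 6)] -/
theorem exists_charts_over (hσ : IsBlowup σ J) (z : X) {k : ℕ} (c : Fin k → X.presheaf.stalk z)
    (hc : Ideal.span (Set.range c) = stalkIdeal J z) :
    ∃ q : (j : Fin k) → (Spec (.of (chartRing c j)) ⟶ X'),
      (∀ j, q j ≫ σ = Spec.map (CommRingCat.ofHom (chartBase c j)) ≫ X.fromSpecStalk z) ∧
      (∀ j (w : Spec (.of (chartRing c j))), IsIso ((q j).stalkMap w)) ∧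
      ∀ x' : X', σ x' = z → ∃ (j : Fin k) (w : Spec (.of (chartRing c j))), q j w = x' := by
  classical
  have hcj : ∀ j, c j ∈ Ideal.span (Set.range c) := fun j => Ideal.mem_span_range_self (f := c) (x := j)
  haveI : Flat (X.fromSpecStalk z) := flat_fromSpecStalk X z
  -- the base change `P = X' ×_X Spec 𝒪_{X,z} → Spec 𝒪_{X,z}` is a blowing up along `(J_z)~ = (c)~`
  have hP : IsBlowup (pullback.snd σ (X.fromSpecStalk z)) (affineBlowup.idealSheaf (Ideal.span (Set.range c))) := by
    have h := hσ.pullback_snd_of_flat (X.fromSpecStalk z)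
    rwa [comap_fromSpecStalk_eq_affineBlowupIdealSheaf, ← hc] at h
  -- hence isomorphic to `Proj 𝒪_{X,z}[J_z t]` over `Spec 𝒪_{X,z}`
  obtain ⟨e, he, -⟩ := (affineBlowup.isBlowup (Ideal.span (Set.range c))).unique hP
  refine ⟨fun j => (affineBlowup.chartι (c j) (hcj j) ≫ e.hom) ≫ pullback.fst σ (X.fromSpecStalk z),
    fun j => ?_, fun j w => ?_, fun x' hx' => ?_⟩
  · rw [Category.assoc, pullback.condition, Category.assoc, reassoc_of% he, ← Category.assoc,
      affineBlowup.chartι_π (c j) (hcj j)]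
  · have h1 := isIso_stalkMap_pullback_fst_fromSpecStalk σ z ((affineBlowup.chartι (c j) (hcj j) ≫ e.hom) w)
    haveI : IsOpenImmersion (affineBlowup.chartι (c j) (hcj j) ≫ e.hom) := inferInstance
    have h2 : IsIso ((affineBlowup.chartι (c j) (hcj j) ≫ e.hom).stalkMap w) := inferInstance
    rw [Scheme.Hom.stalkMap_comp]
    exact @IsIso.comp_isIso _ _ _ _ _ _ _ h1 h2
  · obtain ⟨y, hy⟩ := mem_range_pullback_fst_fromSpecStalk_of_eq σ z hx'
    obtain ⟨t, rfl⟩ : ∃ t, e.hom t = y := ⟨e.inv y, by simp⟩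
    have ht : t ∈ (⊤ : (affineBlowup (Ideal.span (Set.range c))).Opens) := trivial
    rw [← affineBlowup.iSup_chartOpen_eq_top c rfl] at ht
    obtain ⟨j, htj⟩ := Opens.mem_iSup.mp ht
    obtain ⟨w, -, rfl⟩ := htj
    exact ⟨j, w, hy⟩

/-! ## §2 The stalk presentation at a point of a chart, and the dictionary -/

/-- **The stalk presentation at a point of a chart over `z`** (the tree's `exists_stalk_ringHom_of_chart`, transported along
`σ x' = z`): if `q : Spec B_j → X'` lies over `Spec B_j → Spec 𝒪_{X,z} → X`, induces an isomorphism of local rings at `w`, and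
`q w = x'` with `σ x' = z`, then some `χ : B_j → 𝒪_{X',x'}` presents `𝒪_{X',x'}` as the localisation of `B_j` at `w`, with
`χ ∘ (𝒪_{X,z} → B_j) = σ^♯_{x'} ∘ (𝒪_{X,z} ≅ 𝒪_{X,σ x'})` and `w ∩ 𝒪_{X,z} = 𝔪_z`. [cite: StacksProject, Tag 0804] -/
theorem exists_stalk_presentation {z : X} {k : ℕ} (c : Fin k → X.presheaf.stalk z) (j : Fin k)
    (q : Spec (.of (chartRing c j)) ⟶ X') (hq : q ≫ σ = Spec.map (CommRingCat.ofHom (chartBase c j)) ≫ X.fromSpecStalk z)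
    (w : Spec (.of (chartRing c j))) [IsIso (q.stalkMap w)] {x' : X'} (hqw : q w = x') (hz : σ x' = z) :
    ∃ χ : chartRing c j →+* X'.presheaf.stalk x',
      (∀ a, χ (chartBase c j a) = (σ.stalkMap x').hom ((X.presheaf.stalkCongr (.of_eq hz.symm)).hom a)) ∧
      @IsLocalization.AtPrime _ _ (X'.presheaf.stalk x') _ χ.toAlgebra w.asIdeal _ ∧
      w.asIdeal.comap (chartBase c j) = maximalIdeal (X.presheaf.stalk z) := by
  subst hz
  obtain ⟨χ, h1, h2, h3⟩ := exists_stalk_ringHom_of_chart σ x' (CommRingCat.ofHom (chartBase c j)) q w hqw hq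
  refine ⟨χ, fun a => ?_, h2, h3⟩
  rw [BlowupStalkCharts_stalkCongr_refl_apply a]
  exact h1 a
where
  /-- The loop of stalk isomorphisms at one point is the identity. [folklore] -/
  BlowupStalkCharts_stalkCongr_refl_apply {Y : Scheme.{u}} {y : Y} (a : Y.presheaf.stalk y) :
      (Y.presheaf.stalkCongr (.of_eq (rfl : y = y))).hom a = a := by
    change (Y.presheaf.stalkSpecializes (specializes_refl y)).hom a = a
    rw [TopCat.Presheaf.stalkSpecializes_refl]
    rfl

/-! ## §3 The stalk dictionary in a presentation -/

section Dictionary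

variable {z : X} {k : ℕ} {c : Fin k → X.presheaf.stalk z} {j : Fin k} {x' : X'}
  (χ : chartRing c j →+* X'.presheaf.stalk x') (hz : σ x' = z)
  (hχ : ∀ a, χ (chartBase c j a) = (σ.stalkMap x').hom ((X.presheaf.stalkCongr (.of_eq hz.symm)).hom a))

include hχ in
/-- **Pulled-back ideal sheaves**: if `K_z = (k)` then `(σ^*K)_{x'} = (χ φ k)`. [cite: GortzWedhorn2020, (13.19) p. 414] -/
theorem stalkIdeal_comap_of_presentation (K : X.IdealSheafData) (k₀ : X.presheaf.stalk z)
    (hK : stalkIdeal K z = Ideal.span {k₀}) :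
    stalkIdeal (K.comap σ) x' = Ideal.span {χ (chartBase c j k₀)} := by
  subst hz
  rw [stalkIdeal_comap_eq_map_stalkMap, hK, Ideal.map_span, Set.image_singleton, hχ k₀,
    exists_stalk_presentation.BlowupStalkCharts_stalkCongr_refl_apply]

include hχ in
/-- **The exceptional ideal**: `(J·𝒪_{X'})_{x'} = (χ φ c_j)` when `(c) = J_z`. [cite: StacksProject, Tag 0804] -/
theorem stalkIdeal_exceptional_of_presentation (hc : Ideal.span (Set.range c) = stalkIdeal J z) :
    stalkIdeal (J.comap σ) x' = Ideal.span {χ (chartBase c j (c j))} := by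
  subst hz
  have h1 : stalkIdeal (J.comap σ) x' = ((Ideal.span (Set.range c)).map (chartBase c j)).map χ := by
    rw [stalkIdeal_comap_eq_map_stalkMap, ← hc, Ideal.map_map]
    congr 1
    ext a
    simp only [RingHom.comp_apply, hχ, exists_stalk_presentation.BlowupStalkCharts_stalkCongr_refl_apply]
  have h2 : (Ideal.span (Set.range c)).map (chartBase c j) = Ideal.span {chartBase c j (c j)} :=
    span_image_reesChartBase_eq (c j) (Ideal.mem_span_range_self (f := c) (x := j))
  rw [h1, h2, Ideal.map_span, Set.image_singleton]

include hχ in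
/-- **Controlled transforms**: if `K_z = (k₀)` and `φ k₀ = φ(c_j)^μ · f` in the chart ring, then `σᶜ(K, μ)_{x'} = (χ f)` — for a
blowing up `σ` along `J` with `(c) = J_z` and a presentation in which `χ(φ c_j)` is a non-zero-divisor.
[cite: BierstoneGrigorievMilmanWlodarczyk2011, §3.2 Lemma 3.2.1] -/
theorem stalkIdeal_controlledTransform_of_presentation (hσ : IsBlowup σ J) (hc : Ideal.span (Set.range c) = stalkIdeal J z)
    (hnzd : χ (chartBase c j (c j)) ∈ nonZeroDivisors (X'.presheaf.stalk x'))
    (K : X.IdealSheafData) (k₀ : X.presheaf.stalk z) (hK : stalkIdeal K z = Ideal.span {k₀}) (μ : ℕ)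
    (f : chartRing c j) (hf : χ (chartBase c j k₀) = χ (chartBase c j (c j)) ^ μ * χ f) :
    stalkIdeal (controlledTransform σ J K μ) x' = Ideal.span {χ f} := by
  rw [hσ.stalkIdeal_controlledTransform, stalkIdeal_comap_of_presentation χ hz hχ K k₀ hK,
    stalkIdeal_exceptional_of_presentation χ hz hχ hc, hf, Ideal.span_singleton_pow]
  exact colon_span_mul_span_singleton (pow_mem hnzd μ) (χ f)

end Dictionary

/-! ## §4 Simple normal crossings at the point from an adapted part of a regular system of parameters -/

/-- **Simple normal crossings at `x'` from the chart algebra.**  Let `χ : A → 𝒪_{X',x'}` present `𝒪_{X',x'}` as the localisation of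
`A` at the prime `𝔓`, and let `Ds` be a list of ideal sheaves with chart elements `g_D ∈ A` generating their stalks at `x'`
(`D_{x'} = (χ g_D)`, distinct elements for distinct sheaves).  If the `g_D` lying in `𝔓` are, over `χ`, among the members of one
family that is part of a regular system of parameters of `𝒪_{X',x'}` (distinct elements at distinct places), then the family `Ds`
has simple normal crossings at `x'`. [cite: Kollar2007, Def. 3.24] -/
theorem sncWithAt_of_adapted {A : Type u} [CommRing A] {x' : X'} (χ : A →+* X'.presheaf.stalk x') (𝔓 : Ideal A) [𝔓.IsPrime]
    (hloc : @IsLocalization.AtPrime _ _ (X'.presheaf.stalk x') _ χ.toAlgebra 𝔓 _)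
    (Ds : List (X'.IdealSheafData × A)) (hst : ∀ p ∈ Ds, stalkIdeal p.1 x' = Ideal.span {χ p.2})
    (hinj : ∀ p ∈ Ds, ∀ p' ∈ Ds, p.2 = p'.2 → p.1 = p'.1)
    (had : ∃ (m : ℕ) (v : Fin m → X'.presheaf.stalk x') (ι : {g : A // g ∈ Ds.map Prod.snd ∧ g ∈ 𝔓} → Fin m),
      IsRsopPart v ∧ Function.Injective ι ∧ ∀ g, v (ι g) = χ g.1) :
    DepthSNC.SNCWithAt (Ds.map Prod.fst) ⊤ x' := by
  classical
  letI : Algebra A (X'.presheaf.stalk x') := χ.toAlgebra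
  obtain ⟨m, v, ι, hv, hι, hvι⟩ := had
  haveI := hv.isRegularLocalRing
  obtain ⟨e, u, hd, hu, huv⟩ := hv.exists_rsop
  -- the chart element of a member through `x'`, and its membership in `𝔓`
  have hmem : ∀ D : {D : X'.IdealSheafData // D ∈ Ds.map Prod.fst ∧ x' ∈ D.support},
      ∃ p ∈ Ds, p.1 = D.1 := fun D => by
    obtain ⟨p, hp, hpD⟩ := List.mem_map.mp D.2.1
    exact ⟨p, hp, hpD⟩
  have hgP : ∀ (D : {D : X'.IdealSheafData // D ∈ Ds.map Prod.fst ∧ x' ∈ D.support}),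
      (hmem D).choose.2 ∈ Ds.map Prod.snd ∧ (hmem D).choose.2 ∈ 𝔓 := fun D => by
    obtain ⟨hp, hpD⟩ := (hmem D).choose_spec
    refine ⟨List.mem_map.mpr ⟨_, hp, rfl⟩, ?_⟩
    have hle : stalkIdeal D.1 x' ≤ maximalIdeal _ := (mem_support_iff_stalkIdeal_le D.1 x').mp D.2.2
    rw [← hpD, hst _ hp, Ideal.span_singleton_le_iff_mem] at hle
    exact (IsLocalization.AtPrime.to_map_mem_maximal_iff (X'.presheaf.stalk x') 𝔓 _).mp hle
  refine ⟨hv.isRegularLocalRing, m + e, u, hd, hu, ⟨fun D => Fin.castAdd e (ι ⟨(hmem D).choose.2, hgP D⟩), ?_, ?_⟩, ?_⟩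
  · intro D₁ D₂ h
    have h1 := hι (Fin.castAdd_injective _ _ h)
    have h2 : (hmem D₁).choose.2 = (hmem D₂).choose.2 := congrArg Subtype.val h1
    have h3 := hinj _ (hmem D₁).choose_spec.1 _ (hmem D₂).choose_spec.1 h2
    rw [(hmem D₁).choose_spec.2, (hmem D₂).choose_spec.2] at h3
    exact Subtype.ext h3
  · intro D
    rw [huv, hvι]
    conv_lhs => rw [← (hmem D).choose_spec.2]
    exact hst _ (hmem D).choose_spec.1
  · intro hx
    rw [Scheme.IdealSheafData.support_top] at hx
    exact absurd hx id

end ConeDepth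

end Summit.ResolutionOfSingularities.ResolutionOfSingularities.Theorems

end
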